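import Mathlib
import HarnessLib
import HarnessLib.Audit
import Summits.AtomisticToContinuum.Statement
import Literature.MathematicalPhysics.StatisticalMechanics.LennardJonesClusters
import Summits.AtomisticToContinuum.Crystallization.Theses.ThreeConeCertificate
import Summits.AtomisticToContinuum.Crystallization.Theorems.ThreeConeCertificateExactCertificateSplit
import Summits.AtomisticToContinuum.Crystallization.Theorems.ThreeConeCertificateExactCertificateNoGapIff

/-! Re-typing of the split children EXACTLY as the one-line `statement` strings of children.json, inside the route
namespace with the route file's opens, and a check that the landed glue theorems have literally the type
`Child₁ → Child₂ → ExactCertificate` (so `--glue-by` matches). crux-strategist r1. -/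

namespace Summit.AtomisticToContinuum.Crystallization.Theses.ThreeConeCertificate

open scoped BigOperators Topology Manifold Classical MeasureTheory ProbabilityTheory Matrix InnerProductSpace ComplexConjugate ContinuousMap
open Filter Set Function TopologicalSpace MeasureTheory

/-- children.json[0].statement verbatim -/
def NoGapChild : Prop :=
  ∃ ρ₀ : ℝ, ∀ ε : ℝ, 0 < ε → ∃ (Q : Literature.MathematicalPhysics.StatisticalMechanics.PeriodicConfiguration 3) (f : ℝ → ℝ), (∀ (n : ℕ) (y : Fin n → EuclideanSpace ℝ (Fin 3)) (w : Fin n → ℝ), 0 ≤ ∑ i, ∑ j, w i * w j * f (dist (y i) (y j))) ∧ (∀ r : ℝ, ρ₀ ≤ r → 0 < r → f r ≤ Literature.MathematicalPhysics.StatisticalMechanics.lennardJones r) ∧ f 0 + 2 * Q.energyPerParticle (fun r => if r < ρ₀ then f r else 0) + 2 * Q.energyPerParticle (fun r => if r < ρ₀ then 0 else Literature.MathematicalPhysics.StatisticalMechanics.lennardJones r) ≤ ε ∧ (∀ (N : ℕ) (x : Fin N → EuclideanSpace ℝ (Fin 3)), Function.Injective x → (N : ℝ) * (Q.energyPerParticle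 (fun r => if r < ρ₀ then Literature.MathematicalPhysics.StatisticalMechanics.lennardJones r - f r else 0) - ε) ≤ Literature.MathematicalPhysics.StatisticalMechanics.interactionEnergy (fun r => if r < ρ₀ then Literature.MathematicalPhysics.StatisticalMechanics.lennardJones r - f r else 0) x)

/-- children-G2.json[1].statement verbatim (attainment of the periodic infimum; ↔ KeplerBound ↔ 0627) -/
def PeriodicMinimumChild : Prop :=
  ∃ P : Literature.MathematicalPhysics.StatisticalMechanics.PeriodicConfiguration 3, ∀ Q : Literature.MathematicalPhysics.StatisticalMechanics.PeriodicConfiguration 3, P.energyPerParticle Literature.MathematicalPhysics.StatisticalMechanics.lennardJones ≤ Q.energyPerParticle Literature.MathematicalPhysics.StatisticalMechanics.lennardJones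

/-- G1: the landed glue has literally the type `NoGapChild → KeplerBound → ExactCertificate`. -/
theorem glueG1_typechecks : NoGapChild → KeplerBound → ExactCertificate :=
  Summit.AtomisticToContinuum.Crystallization.Theorems.ThreeConeCertificateExactCertificate.Split.ExactCertificate_of_subs

/-- G2: the landed line theorem has literally the type `NoGapChild → PeriodicMinimumChild → ExactCertificate`. -/
theorem glueG2_typechecks : NoGapChild → PeriodicMinimumChild → ExactCertificate :=
  Summit.AtomisticToContinuum.Crystallization.Theorems.ThreeConeCertificateExactCertificate.NoGap.exactCertificate_of_noGap_of_periodicMinimum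

/-- Losslessness, by name. -/
theorem split_iff : ExactCertificate ↔ NoGapChild ∧ KeplerBound :=
  Summit.AtomisticToContinuum.Crystallization.Theorems.ThreeConeCertificateExactCertificate.Split.ExactCertificate_iff_subs

/-- The second piece is conjunct (i) by name (so S → KeplerBound; the converse needs conjunct (ii)). -/
theorem pieceTwo_iff_conjunct_i :
    KeplerBound ↔ Literature.MathematicalPhysics.StatisticalMechanics.HasPeriodicGroundStateEnergy
      Literature.MathematicalPhysics.StatisticalMechanics.lennardJones 3 :=
  Summit.AtomisticToContinuum.Crystallization.Theorems.keplerBound_iff_hasPeriodicGroundStateEnergy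

theorem summit_implies_pieceTwo : _root_.Crystallization → KeplerBound := fun h =>
  (Summit.AtomisticToContinuum.Crystallization.Theorems.crystallization_iff_keplerBound_and_isCrystallizing.mp h).1

end Summit.AtomisticToContinuum.Crystallization.Theses.ThreeConeCertificate
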